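import Literature.AlgebraicGeometry.Motives.AbelianVarietyWeilDivisor
import Literature.AlgebraicGeometry.Motives.CartierDivisorClassPullback
import Literature.AlgebraicGeometry.Motives.AbelianVarietySubgroupOfOpen
import HarnessLib

/-!
# Lange's Cor. 4.4.5 from Step I in Abel–Jacobi currency: `aj(f^♮ t_x^*Θ) = κ·x⁻¹` on a dense open ⟹ `aj(f^♮ D^Θ_u) = u⁻¹` for ALL `u`

Layer `Literature/AlgebraicGeometry/Motives`, namespace `Literature.AlgebraicGeometry.Motives.AbelianVariety`.  KERNEL ONLY: two theorems;
no definition, no named fact, no instance, no `sorry`.  Road G4 of cell `hodgecm-mathlib` (director ruling s225; pen letters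
`A-provers/A-p04/g17/G4.sockets.v5.A-p04g17.lean`): this file cuts the theorem-of-the-square bookkeeping OUT of the Step I leaf, so that leaf
(= [Lange2023AbelianVarietiesComplex] Lem. 4.4.4 Step I = [Milne1986JacobianVarieties] Lem. 6.7) only has to produce the identity
«`aj(f^♮(t_x^*Θ)) = κ · x⁻¹` for the complex points `x` of some non-empty open `U ⊆ A` and some constant `κ`».

For an abelian variety `A` over `ℂ`, a morphism `f : Z → A` from an integral scheme, a divisor `Θ`, and ANY map `aj : CartierDivisor Z → A(ℂ)`
that is additive and constant on linear equivalence classes (`f^♮` = ★ `CartierDivisor.classPullback`, `D^Θ_u = t_u^*Θ − Θ` = ★ `weilDiv`):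
the theorem of the square `D_{u x'} ∼ D_u + D_{x'}` (★ `weilDiv_mul_linEquiv`) gives
`aj(f^♮ t_{ux'}^*Θ) · aj(f^♮(−Θ)) = aj(f^♮ D_u) · aj(f^♮ t_{x'}^*Θ) · aj(f^♮(−Θ))`; choosing a complex point `x'` with `x' ∈ U` and
`u·x' ∈ U` (two non-empty opens of the irreducible `A` share a complex point, ★ `exists_point_pt_mem_inter`) and inserting Step I twice
yields **`aj(f^♮ D^Θ_u) = u⁻¹` for EVERY `u ∈ A(ℂ)`**.  [Lange2023AbelianVarietiesComplex §4.4.2 Lemma 4.4.4 and Cor. 4.4.5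
«`(α_c^*)⁻¹ = −φ_Θ`»; MumfordAV1970 §6 Cor. 4 (theorem of the square).]  COUNT-NEUTRAL.  HC_CM is proved only modulo the 7 printed
citations until rung 0 closes; this file moves no book by itself.
-/

set_option autoImplicit false

noncomputable section

open CategoryTheory AlgebraicGeometry

namespace Literature.AlgebraicGeometry.Motives

namespace AbelianVariety

variable {A : AbelianVariety ℂ} {Z : Scheme.{0}} [IsIntegral Z] (f : Z ⟶ A.X.left) (aj : CartierDivisor Z → A.Points ℂ)
  (haj_add : ∀ D E : CartierDivisor Z, aj (D + E) = aj D * aj E)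
  (haj_lin : ∀ D E : CartierDivisor Z, D.LinEquiv E → aj D = aj E) (Θ : CartierDivisor A.X.left)

include haj_add haj_lin

/-- `aj(f^♮ D^Θ_x) = aj(f^♮ t_x^*Θ) · aj(f^♮(−Θ))` — `D^Θ_x = t_x^*Θ + (−Θ)` by definition and `f^♮` is additive up to linear equivalence
(★ `classPullback_add_linEquiv`). [cite: MumfordAV1970, §8 (definition of φ_L)] -/
theorem aj_classPullback_weilDiv_eq_mul (x : A.Points ℂ) :
    aj ((A.weilDiv Θ x).classPullback f) =
      aj ((Θ.pullback (A.translation x).left).classPullback f) * aj ((-Θ).classPullback f) := by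
  rw [← haj_add]
  exact haj_lin _ _ (CartierDivisor.classPullback_add_linEquiv f _ _)

/-- **Cor. 4.4.5 for all points from Step I in Abel–Jacobi currency** (see the module docstring): if `aj` is additive and constant on
linear equivalence classes and `aj(f^♮ t_x^*Θ) = κ · x⁻¹` for the complex points `x` of a non-empty open `U ⊆ A`, then
`aj(f^♮ D^Θ_u) = u⁻¹` for every `u ∈ A(ℂ)`. [cite: Lange2023AbelianVarietiesComplex, §4.4.2 Lemma 4.4.4 and Cor. 4.4.5]
[cite: MumfordAV1970, §6 Cor. 4] -/
theorem aj_classPullback_weilDiv_eq_inv_of_translate {U : A.X.left.Opens} (hU : (U : Set A.X.left).Nonempty) (κ : A.Points ℂ)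
    (h : ∀ x : A.Points ℂ, x.pt ∈ U → aj ((Θ.pullback (A.translation x).left).classPullback f) = κ * x⁻¹)
    (u : A.Points ℂ) : aj ((A.weilDiv Θ u).classPullback f) = u⁻¹ := by
  -- a complex point `x'` with `x' ∈ U` and `u · x' ∈ U`
  set V : Set A.X.left := (A.translation u).left ⁻¹' (U : Set A.X.left) with hV
  have hVo : IsOpen V := U.isOpen.preimage (A.translation u).left.continuous
  have hVne : V.Nonempty := by
    obtain ⟨y, hy⟩ := hU
    refine ⟨(A.translation u⁻¹).left y, ?_⟩
    show (A.translation u).left ((A.translation u⁻¹).left y) ∈ (U : Set A.X.left)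
    rw [← Scheme.Hom.comp_apply, ← Over.comp_left, translation_inv_comp_translation]
    exact hy
  obtain ⟨x', hx'U, hx'V⟩ := A.exists_point_pt_mem_inter U.isOpen hVo hU hVne
  have hux' : (u * x').pt ∈ (U : Set A.X.left) := by
    rw [← translation_apply_pt]
    exact hx'V
  -- theorem of the square `D_{u x'} ∼ D_u + D_{x'}`, read through `aj ∘ f^♮`
  have hsq : aj ((A.weilDiv Θ (u * x')).classPullback f) =
      aj ((A.weilDiv Θ u).classPullback f) * aj ((A.weilDiv Θ x').classPullback f) := by
    rw [← haj_add]
    exact haj_lin _ _ (((A.weilDiv_mul_linEquiv Θ u x').classPullback f).trans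
      (CartierDivisor.classPullback_add_linEquiv f _ _))
  rw [aj_classPullback_weilDiv_eq_mul f aj haj_add haj_lin Θ (u * x'),
    aj_classPullback_weilDiv_eq_mul f aj haj_add haj_lin Θ x', h _ hux', h _ hx'U, ← mul_assoc] at hsq
  -- `κ (u x')⁻¹ = aj(f^♮ D_u) · κ x'⁻¹`, and `κ (u x')⁻¹ = u⁻¹ · κ x'⁻¹`
  have h2 : aj ((A.weilDiv Θ u).classPullback f) * (κ * x'⁻¹) = u⁻¹ * (κ * x'⁻¹) := by
    rw [← mul_right_cancel hsq, mul_inv, mul_left_comm]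
  exact mul_right_cancel h2

end AbelianVariety

end Literature.AlgebraicGeometry.Motives

end
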